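import Mathlib.GroupTheory.DoubleCoset
import Mathlib.GroupTheory.GroupAction.Quotient
import Mathlib.GroupTheory.GroupAction.FixedPoints
import Mathlib.Algebra.GroupWithZero.Units.Fintype
import Mathlib.Data.ZMod.Basic
import Mathlib.Tactic.Group
import Mathlib.Tactic.LinearCombination

/-!
# [EtTh] Corollary 2.9 (labels of cusps): the counting lemma `#(ℤ/lℤ)^± = (l+1)/2` for double cosets
# (proof-only support file)

Mochizuki, *The Étale Theta Function …* [EtTh], Publ. RIMS 45 (2009), §2, Corollary 2.9, PRIMS text
pp.42–43 (printed 268–269; locators = PDF pages; bib key `MochizukiEtTh2009`): "If we write `(ℤ/lℤ)^±` for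
the quotient of the set `ℤ/lℤ` by the natural multiplicative action of `±1` … the labels … determine a
bijection of the set `(ℤ/lℤ)^±` with the set of 'Aut_K(−)'-orbits of the cusps" [cite: MochizukiEtTh2009,
Cor 2.9 p.43].

Cell abc-iut, layer L2, discharge seat abc-iut-L2-d3 (node EtTh:Cor2.9), support for the companion
`Sec2CuspOrbits.lean` of seat abc-iut-L2-t2's `ThetaCoversTempered.lean` (`Cor29_card`: the orbit sets are
the double coset spaces `N_{Π^tp_C}(Π^tp_Z)\Π^tp_C/cuspStabC`, the count is `(l+1)/2`). Mathlib-only,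
pure group theory:

* `natCard_orbitRel_quotient_units_int_zmod` — `#((ℤ/lℤ)/{±1}) = (l+1)/2` for `l` odd (Burnside);
* `natCard_doubleCoset_quotient_of_reflection` — `#(N\G/D) = (l+1)/2` when a coordinate `f : G → ℤ/lℤ`
  identifies `N\G` with `ℤ/lℤ` and `D` acts through `{id, x ↦ c₀ − x}`.

No definition, no named fact; no side is taken on any disputed claim.
-/

namespace Literature.AnabelianGeometry.EtaleTheta

namespace ThetaCovers

open MulAction in
/-- The orbits of `ℤˣ = {±1}` on `ℤ/lℤ` (`l` odd) — the classes of "the quotient `(ℤ/lℤ)^±` of the set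
`ℤ/lℤ` by the natural multiplicative action of `±1`" (p.43): there are `(l+1)/2` of them (Burnside: the
fixed points of `−1` are the solutions of `2x = 0`, i.e. `x = 0` as `l` is odd).
[cite: MochizukiEtTh2009, Cor 2.9 p.43] -/
theorem natCard_orbitRel_quotient_units_int_zmod {l : ℕ} (hl : Odd l) :
    Nat.card (orbitRel.Quotient ℤˣ (ZMod l)) = (l + 1) / 2 := by
  classical
  haveI : NeZero l := ⟨by obtain ⟨k, hk⟩ := hl; omega⟩
  have key := MulAction.sum_card_fixedBy_eq_card_orbits_mul_card_group ℤˣ (ZMod l)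
  rw [UnitsInt.univ, Finset.sum_pair (by decide : (1 : ℤˣ) ≠ -1), Fintype.card_units_int] at key
  have h1 : Fintype.card (fixedBy (ZMod l) (1 : ℤˣ)) = l := by
    rw [← Nat.card_eq_fintype_card, fixedBy_one_eq_univ, Nat.card_univ, Nat.card_zmod]
  have h2 : Fintype.card (fixedBy (ZMod l) (-1 : ℤˣ)) = 1 := by
    rw [← Nat.card_eq_fintype_card, Nat.card_eq_one_iff_unique]
    refine ⟨⟨fun a b => ?_⟩, ⟨⟨0, by simp⟩⟩⟩
    have key2 : ∀ x : ZMod l, x ∈ fixedBy (ZMod l) (-1 : ℤˣ) → x = 0 := by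
      intro x hx
      rw [mem_fixedBy, Units.smul_def, Units.val_neg, Units.val_one, neg_smul, one_smul,
        neg_eq_iff_add_eq_zero, ← two_mul] at hx
      have h2u : IsUnit (2 : ZMod l) := by
        have := (ZMod.isUnit_iff_coprime 2 l).mpr (Nat.coprime_two_left.mpr hl)
        exact_mod_cast this
      exact (h2u.mul_right_eq_zero).mp hx
    exact Subtype.ext ((key2 a a.2).trans (key2 b b.2).symm)
  rw [h1, h2] at key
  rw [Nat.card_eq_fintype_card]
  change l + 1 = Fintype.card (orbitRel.Quotient ℤˣ (ZMod l)) * 2 at key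
  omega

open MulAction in
/-- **Counting `Aut_K`-orbits of cusps** (the combinatorics of Cor 2.9): double cosets `N\G/D` counted
through a "coordinate" `f : G → ℤ/lℤ` (`l` odd) inducing a bijection `N\G ≅ ℤ/lℤ` on which the right action
of `D` is by the identity and by ONE reflection `x ↦ c₀ − x` — then `#(N\G/D) = #(ℤ/lℤ)^± = (l+1)/2`.
[cite: MochizukiEtTh2009, Cor 2.9 p.43] -/
theorem natCard_doubleCoset_quotient_of_reflection {G : Type*} [Group G] {l : ℕ} (hl : Odd l)
    (N D : Subgroup G) (f : G → ZMod l) (hsurj : Function.Surjective f)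
    (hN : ∀ a b, f a = f b ↔ ∃ n ∈ N, b = n * a) (c₀ : ZMod l)
    (hD : ∀ k ∈ D, (∀ a, f (a * k) = f a) ∨ (∀ a, f (a * k) = c₀ - f a))
    (hk₀ : ∃ k₀ ∈ D, ∀ a, f (a * k₀) = c₀ - f a) :
    Nat.card (DoubleCoset.Quotient (N : Set G) (D : Set G)) = (l + 1) / 2 := by
  classical
  haveI : NeZero l := ⟨by obtain ⟨k, hk⟩ := hl; omega⟩
  -- centre the reflection: `g a := f a − h` with `2h = c₀`
  have h2u : IsUnit (2 : ZMod l) := by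
    have := (ZMod.isUnit_iff_coprime 2 l).mpr (Nat.coprime_two_left.mpr hl)
    exact_mod_cast this
  obtain ⟨u, hu⟩ := h2u
  set h : ZMod l := (u⁻¹ : (ZMod l)ˣ) * c₀ with hh
  have h2h : c₀ - h = h := by
    have : (2 : ZMod l) * h = c₀ := by rw [hh, ← mul_assoc, ← hu, Units.mul_inv, one_mul]
    linear_combination (-1 : ZMod l) * this
  let g : G → ZMod l := fun a => f a - h
  have hg_refl : ∀ a b, f b = c₀ - f a → g b = -g a := by
    intro a b hab; change f b - h = -(f a - h); rw [hab]; linear_combination h2h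
  -- the comparison map to the `{±1}`-orbits of `ℤ/lℤ`
  have hcompat : ∀ a b : G, DoubleCoset.setoid (N : Set G) (D : Set G) a b →
      (Quotient.mk (orbitRel ℤˣ (ZMod l)) (g a) : orbitRel.Quotient ℤˣ (ZMod l)) =
        Quotient.mk _ (g b) := by
    intro a b hab
    obtain ⟨n, hn, k, hk, rfl⟩ := DoubleCoset.rel_iff.mp hab
    have hna : f (n * a) = f a := ((hN a (n * a)).mpr ⟨n, hn, rfl⟩).symm
    apply Quotient.sound
    change g a ∈ orbit ℤˣ (g (n * a * k))
    rcases hD k hk with hk1 | hk2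
    · refine ⟨1, ?_⟩
      change (1 : ℤˣ) • g (n * a * k) = g a
      rw [one_smul]; change f (n * a * k) - h = f a - h; rw [hk1, hna]
    · refine ⟨-1, ?_⟩
      change (-1 : ℤˣ) • g (n * a * k) = g a
      rw [Units.smul_def, Units.val_neg, Units.val_one, neg_smul, one_smul,
        hg_refl a (n * a * k) (by rw [hk2, hna]), neg_neg]
  let Φ : DoubleCoset.Quotient (N : Set G) (D : Set G) → orbitRel.Quotient ℤˣ (ZMod l) :=
    Quotient.lift (fun a => Quotient.mk (orbitRel ℤˣ (ZMod l)) (g a)) hcompat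
  have hΦ : ∀ a : G, Φ (DoubleCoset.mk N D a) = Quotient.mk _ (g a) := fun a => rfl
  obtain ⟨k₀, hk₀D, hk₀⟩ := hk₀
  have hbij : Function.Bijective Φ := by
    constructor
    · intro p q hpq
      induction p using Quotient.inductionOn with
      | h a =>
        induction q using Quotient.inductionOn with
        | h b =>
          change Φ (DoubleCoset.mk N D a) = Φ (DoubleCoset.mk N D b) at hpq
          rw [hΦ, hΦ] at hpq
          change DoubleCoset.mk N D a = DoubleCoset.mk N D b
          rw [DoubleCoset.eq]
          obtain ⟨v, hv⟩ := Quotient.exact hpq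
          change v • g b = g a at hv
          rcases Int.units_eq_one_or v with rfl | rfl
          · rw [one_smul] at hv
            have hab : f a = f b := by
              have : g b = g a := hv
              change f b - h = f a - h at this
              linear_combination -this
            obtain ⟨n, hn, rfl⟩ := (hN a b).mp hab
            exact ⟨n, hn, 1, D.one_mem, by group⟩
          · rw [Units.smul_def, Units.val_neg, Units.val_one, neg_smul, one_smul] at hv
            -- `g a = -g b`, so `f b = c₀ - f a = f (a k₀)`
            have hab : f (a * k₀) = f b := by
              rw [hk₀]
              have : -g b = g a := hv
              change -(f b - h) = f a - h at this
              linear_combination this + h2h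
            obtain ⟨n, hn, rfl⟩ := (hN (a * k₀) b).mp hab
            exact ⟨n, hn, k₀, hk₀D, by group⟩
    · intro q
      induction q using Quotient.inductionOn with
      | h x =>
        obtain ⟨a, ha⟩ := hsurj (x + h)
        refine ⟨DoubleCoset.mk N D a, ?_⟩
        rw [hΦ]
        congr 1
        change f a - h = x
        rw [ha, add_sub_cancel_right]
  rw [Nat.card_eq_of_bijective Φ hbij, natCard_orbitRel_quotient_units_int_zmod hl]

end ThetaCovers

end Literature.AnabelianGeometry.EtaleTheta
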